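import Summits.HodgeConjecture.HodgeConjecture.Theorems.LinearSystemTorelliLocalTubeSpanTheoremUStep
import Summits.HodgeConjecture.HodgeConjecture.Theorems.LinearSystemTorelliLocalTubeSpanSquaresAll
import Summits.HodgeConjecture.HodgeConjecture.Theorems.LinearSystemTorelliLocalTubeSpanUniStar

/-!
# Route LinearSystemTorelli — crux `LocalTubeSpan` (stmt-HodgeConjecture-2490): THEOREM U

Composition file of line `Sketch`, cycle 9 (continuation lead c7).  **THEOREM U**: let `Λ = ℤS` be a finitely
generated lattice spanning the `ℚ`-space `V`, with the alternating form `B` integral on `S` and UNIMODULAR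
MODULO ITS RADICAL in the form `UNI⋆` (every lattice vector pairing non-trivially with `Λ` is `c • x₀ + r` with
`x₀ ∈ Λ` unimodular, `c ∈ ℤ`, `r ∈ Λ` radical).  If a subgroup `G ≤ GL(V)` contains a unit acting as `T_a²` for
every `a ∈ Λ`, then every unit satisfying the four `Sp♯₂(Λ)` conditions (the hypotheses of
`Janssen1983_thm2_5`) lies in `G` — the level-2 congruence subgroup is generated by squares of transvections
(`localTubeSpan_theoremU`).  Proof: multi-plane descent (`localTubeSpan_theoremU_step`) along a growing
symplectic family `u₁,w₁,…,u_k,w_k`; a symplectic family is linearly independent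
(`localTubeSpan_symplecticFamily_card_le`), so after at most `dim V / 2` steps the orthogonal of the family
inside `Λ` is radical, where an element of `Sp♯₂(Λ)` fixing the family is the identity
(`localTubeSpan_theoremU_isotropicEnd`).

With Part A of cycle 9 (`T_a² ∈ Γ_Δ` for all `a ∈ ℤΔ`) this yields the conclusion of Janssen's Theorem 2.5 for
every skew vanishing lattice unimodular modulo its radical.  No named facts; no `sorry`.
-/

-- `Summit.HodgeConjecture.HodgeConjecture.Theorems` is the mandated namespace (single-conjunct summit:
-- Sub = Summit), which `linter.dupNamespace` flags on every declaration; the lakefile turns the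
-- linter off tree-wide (weak option), restated here so stand-alone elaboration is warning-free too.
set_option linter.dupNamespace false

noncomputable section

open Literature.AlgebraicGeometry.HodgeTheory

namespace Summit.HodgeConjecture.HodgeConjecture.Theorems

variable {V : Type} [AddCommGroup V] [Module ℚ V]

/-- A symplectic family `uu i, ww i` (`⟨uu i, uu j⟩ = ⟨ww i, ww j⟩ = 0`, `⟨uu i, ww j⟩ = δᵢⱼ`) of `k` pairs in a
finite-dimensional space has `2k ≤ dim V` (it is linearly independent: pair a vanishing combination with
`ww j` and `uu j`). [folklore] -/
theorem localTubeSpan_symplecticFamily_card_le [FiniteDimensional ℚ V] (B : LinearMap.BilinForm ℚ V)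
    {k : ℕ} (uu ww : Fin k → V) (hU : ∀ i j, B (uu i) (uu j) = 0) (hW : ∀ i j, B (ww i) (ww j) = 0)
    (hUW : ∀ i j, B (uu i) (ww j) = if i = j then 1 else 0)
    (hWU : ∀ i j, B (ww i) (uu j) = if i = j then -1 else 0) :
    2 * k ≤ Module.finrank ℚ V := by
  classical
  -- the family indexed by `Fin k ⊕ Fin k`
  let f : Fin k ⊕ Fin k → V := fun s => Sum.elim uu ww s
  have hf : LinearIndependent ℚ f := by
    rw [linearIndependent_iff']
    intro s c hc i hi
    have e1 : ∀ j : Fin k, ∀ t ∈ s, c t * B (f t) (ww j) = if t = Sum.inl j then c t else 0 := by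
      intro j t _
      rcases t with t | t
      · simp only [f, Sum.elim_inl, hUW, Sum.inl.injEq]
        split_ifs with h <;> simp [h]
      · simp only [f, Sum.elim_inr, hW, mul_zero, reduceCtorEq, if_false]
    have e2 : ∀ j : Fin k, ∀ t ∈ s, c t * B (f t) (uu j) = if t = Sum.inr j then -c t else 0 := by
      intro j t _
      rcases t with t | t
      · simp only [f, Sum.elim_inl, hU, mul_zero, reduceCtorEq, if_false]
      · simp only [f, Sum.elim_inr, hWU, Sum.inr.injEq]
        split_ifs with h <;> simp [h]
    rcases i with j | j
    · have h1 := congrArg (fun v => B v (ww j)) hc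
      simp only [map_sum, map_smul, LinearMap.coe_sum, Finset.sum_apply, LinearMap.smul_apply,
        smul_eq_mul, map_zero, LinearMap.zero_apply] at h1
      rw [Finset.sum_congr rfl (e1 j), Finset.sum_ite_eq' s (Sum.inl j), if_pos hi] at h1
      exact h1
    · have h2 := congrArg (fun v => B v (uu j)) hc
      simp only [map_sum, map_smul, LinearMap.coe_sum, Finset.sum_apply, LinearMap.smul_apply,
        smul_eq_mul, map_zero, LinearMap.zero_apply] at h2
      rw [Finset.sum_congr rfl (e2 j), Finset.sum_ite_eq' s (Sum.inr j), if_pos hi] at h2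
      exact neg_eq_zero.1 h2
  have := hf.fintype_card_le_finrank
  simpa [Fintype.card_sum, Fintype.card_fin, two_mul] using this


/-- **Theorem U, the isotropic end.**  If the orthogonal of the symplectic family `uu i, ww i ∈ Λ` inside
`Λ = ℤS` pairs trivially with `Λ` (it is radical), then a unit satisfying Schnell's `Sp♯₂(Λ)` condition and
fixing the family is the identity. [cite: Janssen1983, Thm. 2.5] -/
theorem localTubeSpan_theoremU_isotropicEnd [FiniteDimensional ℚ V] (B : LinearMap.BilinForm ℚ V)
    (hB : B.IsAlt) (S : Set V) (hint : ∀ δ ∈ S, ∀ δ' ∈ S, ∃ n : ℤ, B δ δ' = n)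
    (hfg : (Submodule.span ℤ S).FG) (hsp : Submodule.span ℚ S = ⊤)
    {k : ℕ} (uu ww : Fin k → V) (huu : ∀ i, uu i ∈ Submodule.span ℤ S) (hww : ∀ i, ww i ∈ Submodule.span ℤ S)
    (hU : ∀ i j, B (uu i) (uu j) = 0) (hUW : ∀ i j, B (uu i) (ww j) = if i = j then 1 else 0)
    (hW : ∀ i j, B (ww i) (ww j) = 0)
    (hrad : ∀ m ∈ Submodule.span ℤ S, (∀ i, B (uu i) m = 0 ∧ B (ww i) m = 0) →
      ∀ y ∈ Submodule.span ℤ S, B m y = 0)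
    (g : (V →ₗ[ℚ] V)ˣ)
    (h4 : ∀ l : V →ₗ[ℚ] ℚ, (∀ a ∈ Submodule.span ℤ S, ∃ z : ℤ, l a = z) →
      ∃ v ∈ Submodule.span ℤ S, ∀ a ∈ Submodule.span ℤ S, l ((g : V →ₗ[ℚ] V) a - a) = 2 * B v a)
    (hfix : ∀ i, (g : V →ₗ[ℚ] V) (uu i) = uu i ∧ (g : V →ₗ[ℚ] V) (ww i) = ww i) : g = 1 := by
  classical
  have hWU : ∀ i j, B (ww i) (uu j) = if i = j then -1 else 0 := fun i j => by
    rw [← hB.neg_eq, hUW]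
    split_ifs with h1 h2 h2
    · rfl
    · exact absurd h1.symm h2
    · exact absurd h2.symm h1
    · rw [neg_zero]
  -- vectors of `Λ` orthogonal to the family are fixed
  have hfixL : ∀ m ∈ Submodule.span ℤ S, (∀ i, B (uu i) m = 0 ∧ B (ww i) m = 0) →
      (g : V →ₗ[ℚ] V) m = m := by
    intro m hm hmo
    have h0 : (g : V →ₗ[ℚ] V) m - m = 0 := by
      refine localTubeSpan_eq_zero_of_integral_functionals S hfg hsp fun l hl => ?_
      obtain ⟨v, hv, hvx⟩ := h4 l hl
      rw [hvx m hm, ← hB.neg_eq, hrad m hm hmo v hv, neg_zero, mul_zero]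
    exact sub_eq_zero.1 h0
  -- the projection away from the family
  let π : V → V := fun x => x - ∑ i, (B x (ww i) • uu i - B x (uu i) • ww i)
  have hπmem : ∀ x ∈ Submodule.span ℤ S, π x ∈ Submodule.span ℤ S := by
    intro x hx
    refine Submodule.sub_mem _ hx (Submodule.sum_mem _ fun i _ => ?_)
    obtain ⟨a, ha⟩ := localTubeSpan_integral_span B S hint hx (hww i)
    obtain ⟨b, hb⟩ := localTubeSpan_integral_span B S hint hx (huu i)
    rw [ha, hb]
    exact Submodule.sub_mem _ (localTubeSpan_intCast_smul_mem S (huu i) a)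
      (localTubeSpan_intCast_smul_mem S (hww i) b)
  have hπu : ∀ x j, B (uu j) (π x) = 0 := by
    intro x j
    simp only [π, map_sub, map_sum, map_smul, smul_eq_mul, hU, hUW, mul_zero, zero_sub, mul_ite,
      mul_one, Finset.sum_neg_distrib, Finset.sum_ite_eq, Finset.mem_univ, if_true, sub_neg_eq_add]
    rw [← hB.neg_eq x (uu j)]
    ring
  have hπw : ∀ x j, B (ww j) (π x) = 0 := by
    intro x j
    simp only [π, map_sub, map_sum, map_smul, smul_eq_mul, hW, hWU, mul_zero, sub_zero, mul_ite,
      mul_neg, mul_one, Finset.sum_ite_eq, Finset.mem_univ, if_true]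
    rw [← hB.neg_eq x (ww j)]
    ring
  have hfixΛ : ∀ x ∈ Submodule.span ℤ S, (g : V →ₗ[ℚ] V) x = x := by
    intro x hx
    have h := hfixL (π x) (hπmem x hx) fun i => ⟨hπu x i, hπw x i⟩
    have hgsum : (g : V →ₗ[ℚ] V) (∑ i, (B x (ww i) • uu i - B x (uu i) • ww i)) =
        ∑ i, (B x (ww i) • uu i - B x (uu i) • ww i) := by
      rw [map_sum]
      refine Finset.sum_congr rfl fun i _ => ?_
      rw [map_sub, map_smul, map_smul, (hfix i).1, (hfix i).2]
    have e : (g : V →ₗ[ℚ] V) (π x) = (g : V →ₗ[ℚ] V) x - ∑ i, (B x (ww i) • uu i - B x (uu i) • ww i) := by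
      show (g : V →ₗ[ℚ] V) (x - _) = _
      rw [map_sub, hgsum]
    rw [e] at h
    exact sub_left_injective h
  have hfixV : ∀ x : V, (g : V →ₗ[ℚ] V) x = x := by
    intro x
    have hx : x ∈ Submodule.span ℚ S := by rw [hsp]; trivial
    induction hx using Submodule.span_induction with
    | mem y hy => exact hfixΛ y (Submodule.subset_span hy)
    | zero => rw [map_zero]
    | add y z _ _ hy hz => rw [map_add, hy, hz]
    | smul c y _ hy => rw [map_smul, hy]
  exact Units.ext (LinearMap.ext fun x => by rw [hfixV x, Units.val_one, Module.End.one_apply])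

/-- **THEOREM U.**  Let `Λ = ℤS` be finitely generated and spanning, `B` alternating and integral on `S`, and
`UNI⋆`: every `x ∈ Λ` pairing non-trivially with `Λ` is `c • x₀ + r` with `x₀ ∈ Λ` unimodular (`⟨x₀, y⟩ = 1`
for some `y ∈ Λ`), `c ∈ ℤ` and `r ∈ Λ` radical.  If `G ≤ GL(V)` contains a unit acting as `T_a²` for every
`a ∈ Λ`, then every unit satisfying the four `Sp♯₂(Λ)` conditions lies in `G`: **the level-2 congruence
subgroup of a lattice unimodular modulo its radical is generated by squares of transvections.**
(Multi-plane descent `localTubeSpan_theoremU_step` along a growing symplectic family, which has at most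
`dim V / 2` pairs; at the end the orthogonal of the family in `Λ` is radical and `localTubeSpan_theoremU_isotropicEnd`
applies.) [cite: Janssen1983, Thm. 2.5] -/
theorem localTubeSpan_theoremU [FiniteDimensional ℚ V] (B : LinearMap.BilinForm ℚ V) (hB : B.IsAlt)
    (S : Set V) (hint : ∀ δ ∈ S, ∀ δ' ∈ S, ∃ n : ℤ, B δ δ' = n) (hfg : (Submodule.span ℤ S).FG)
    (hsp : Submodule.span ℚ S = ⊤)
    (huni : ∀ x ∈ Submodule.span ℤ S, (∃ y ∈ Submodule.span ℤ S, B x y ≠ 0) →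
      ∃ x₀ ∈ Submodule.span ℤ S, ∃ c : ℤ, ∃ r ∈ Submodule.span ℤ S,
        (∀ y ∈ Submodule.span ℤ S, B r y = 0) ∧ x = (c : ℚ) • x₀ + r ∧
        ∃ y ∈ Submodule.span ℤ S, B x₀ y = 1)
    (G : Subgroup (V →ₗ[ℚ] V)ˣ)
    (hsq : ∀ a ∈ Submodule.span ℤ S, ∃ g ∈ G, ∀ v : V,
      ((g : (V →ₗ[ℚ] V)ˣ) : V →ₗ[ℚ] V) v = v - (2 : ℚ) • (B v a • a))
    (g : (V →ₗ[ℚ] V)ˣ)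
    (h1 : ∀ x y : V, B ((g : V →ₗ[ℚ] V) x) ((g : V →ₗ[ℚ] V) y) = B x y)
    (h2 : ∀ x ∈ Submodule.span ℤ S, (g : V →ₗ[ℚ] V) x ∈ Submodule.span ℤ S)
    (h3 : ∀ x ∈ Submodule.span ℤ S, ((g⁻¹ : (V →ₗ[ℚ] V)ˣ) : V →ₗ[ℚ] V) x ∈ Submodule.span ℤ S)
    (h4 : ∀ l : V →ₗ[ℚ] ℚ, (∀ x ∈ Submodule.span ℤ S, ∃ z : ℤ, l x = z) →
      ∃ v ∈ Submodule.span ℤ S, ∀ x ∈ Submodule.span ℤ S, l ((g : V →ₗ[ℚ] V) x - x) = 2 * B v x) :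
    g ∈ G := by
  classical
  -- the `Sp♯₂` predicate
  let C : (V →ₗ[ℚ] V)ˣ → Prop := fun g =>
    (∀ a b : V, B ((g : V →ₗ[ℚ] V) a) ((g : V →ₗ[ℚ] V) b) = B a b) ∧
    (∀ a ∈ Submodule.span ℤ S, (g : V →ₗ[ℚ] V) a ∈ Submodule.span ℤ S) ∧
    (∀ a ∈ Submodule.span ℤ S, ((g⁻¹ : (V →ₗ[ℚ] V)ˣ) : V →ₗ[ℚ] V) a ∈ Submodule.span ℤ S) ∧
    (∀ l : V →ₗ[ℚ] ℚ, (∀ a ∈ Submodule.span ℤ S, ∃ z : ℤ, l a = z) →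
      ∃ v ∈ Submodule.span ℤ S, ∀ a ∈ Submodule.span ℤ S,
        l ((g : V →ₗ[ℚ] V) a - a) = 2 * B v a)
  have hCmul : ∀ g h, C g → C h → C (g * h) := fun g h hg hh =>
    localTubeSpan_sp2Cond_mul B S g h hg.1 hg.2.1 hg.2.2.1 hg.2.2.2 hh.1 hh.2.1 hh.2.2.1 hh.2.2.2
  have hCinv : ∀ g, C g → C g⁻¹ := fun g hg =>
    localTubeSpan_sp2Cond_inv B S g hg.1 hg.2.1 hg.2.2.1 hg.2.2.2
  -- the inductive statement: families of `k` pairs, `dim V ≤ 2k + n`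
  suffices key : ∀ (n k : ℕ) (uu ww : Fin k → V), (∀ i, uu i ∈ Submodule.span ℤ S) →
      (∀ i, ww i ∈ Submodule.span ℤ S) → (∀ i j, B (uu i) (uu j) = 0) →
      (∀ i j, B (uu i) (ww j) = if i = j then 1 else 0) → (∀ i j, B (ww i) (ww j) = 0) →
      Module.finrank ℚ V ≤ 2 * k + n →
      ∀ g : (V →ₗ[ℚ] V)ˣ, C g → (∀ i, (g : V →ₗ[ℚ] V) (uu i) = uu i ∧ (g : V →ₗ[ℚ] V) (ww i) = ww i) →
        g ∈ G by
    exact key (Module.finrank ℚ V) 0 Fin.elim0 Fin.elim0 (fun i => i.elim0) (fun i => i.elim0)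
      (fun i => i.elim0) (fun i => i.elim0) (fun i => i.elim0) (by omega) g ⟨h1, h2, h3, h4⟩
      (fun i => i.elim0)
  -- from a non-radical vector orthogonal to the family: a new unimodular pair orthogonal to the family
  have hnewpair : ∀ (k : ℕ) (uu ww : Fin k → V), (∀ i, uu i ∈ Submodule.span ℤ S) →
      (∀ i, ww i ∈ Submodule.span ℤ S) → (∀ i j, B (uu i) (uu j) = 0) →
      (∀ i j, B (uu i) (ww j) = if i = j then 1 else 0) → (∀ i j, B (ww i) (ww j) = 0) →
      (∃ m ∈ Submodule.span ℤ S, (∀ i, B (uu i) m = 0 ∧ B (ww i) m = 0) ∧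
        ∃ y ∈ Submodule.span ℤ S, B m y ≠ 0) →
      ∃ x₀ ∈ Submodule.span ℤ S, ∃ y₁ ∈ Submodule.span ℤ S, B x₀ y₁ = 1 ∧
        (∀ i, B (uu i) x₀ = 0 ∧ B (ww i) x₀ = 0) ∧ (∀ i, B (uu i) y₁ = 0 ∧ B (ww i) y₁ = 0) := by
    intro k uu ww huu hww hU hUW hW ⟨m, hm, hmo, y, hy, hne⟩
    have hWU : ∀ i j, B (ww i) (uu j) = if i = j then -1 else 0 := fun i j => by
      rw [← hB.neg_eq, hUW]
      split_ifs with h1 h2 h2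
      · rfl
      · exact absurd h1.symm h2
      · exact absurd h2.symm h1
      · rw [neg_zero]
    obtain ⟨x₀, hx₀, c, r, hr, hrrad, hdec, y₀, hy₀, hx₀y₀⟩ := huni m hm ⟨y, hy, hne⟩
    have hc : (c : ℚ) ≠ 0 := by
      intro hc0
      apply hne
      rw [hdec, hc0, zero_smul, zero_add, hrrad y hy]
    have hx₀o : ∀ i, B (uu i) x₀ = 0 ∧ B (ww i) x₀ = 0 := by
      intro i
      constructor
      · have h := (hmo i).1
        rw [hdec, map_add, map_smul, smul_eq_mul, ← hB.neg_eq r, hrrad (uu i) (huu i), neg_zero,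
          add_zero] at h
        exact (mul_eq_zero.1 h).resolve_left hc
      · have h := (hmo i).2
        rw [hdec, map_add, map_smul, smul_eq_mul, ← hB.neg_eq r, hrrad (ww i) (hww i), neg_zero,
          add_zero] at h
        exact (mul_eq_zero.1 h).resolve_left hc
    -- project the partner away from the family
    refine ⟨x₀, hx₀, y₀ - ∑ i, (B y₀ (ww i) • uu i - B y₀ (uu i) • ww i), ?_, ?_, hx₀o, ?_⟩
    · refine Submodule.sub_mem _ hy₀ (Submodule.sum_mem _ fun i _ => ?_)
      obtain ⟨a, ha⟩ := localTubeSpan_integral_span B S hint hy₀ (hww i)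
      obtain ⟨b, hb⟩ := localTubeSpan_integral_span B S hint hy₀ (huu i)
      rw [ha, hb]
      exact Submodule.sub_mem _ (localTubeSpan_intCast_smul_mem S (huu i) a)
        (localTubeSpan_intCast_smul_mem S (hww i) b)
    · have hxu : ∀ i, B x₀ (uu i) = 0 := fun i => by rw [← hB.neg_eq, (hx₀o i).1, neg_zero]
      have hxw : ∀ i, B x₀ (ww i) = 0 := fun i => by rw [← hB.neg_eq, (hx₀o i).2, neg_zero]
      simp only [map_sub, map_sum, map_smul, smul_eq_mul, hxu, hxw, mul_zero, sub_zero,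
        Finset.sum_const_zero, hx₀y₀]
    · intro j
      constructor
      · simp only [map_sub, map_sum, map_smul, smul_eq_mul, hU, hUW, mul_zero, zero_sub, mul_ite,
          mul_one, Finset.sum_neg_distrib, Finset.sum_ite_eq, Finset.mem_univ, if_true, sub_neg_eq_add]
        rw [← hB.neg_eq y₀ (uu j)]
        ring
      · simp only [map_sub, map_sum, map_smul, smul_eq_mul, hW, hWU, mul_zero, sub_zero, mul_ite,
          mul_neg, mul_one, Finset.sum_ite_eq, Finset.mem_univ, if_true]
        rw [← hB.neg_eq y₀ (ww j)]
        ring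
  -- extending a symplectic family by a new orthogonal pair
  have hext : ∀ (k : ℕ) (uu ww : Fin k → V) (x₀ y₁ : V), (∀ i j, B (uu i) (uu j) = 0) →
      (∀ i j, B (uu i) (ww j) = if i = j then 1 else 0) → (∀ i j, B (ww i) (ww j) = 0) →
      B x₀ y₁ = 1 → (∀ i, B (uu i) x₀ = 0 ∧ B (ww i) x₀ = 0) → (∀ i, B (uu i) y₁ = 0 ∧ B (ww i) y₁ = 0) →
      (∀ i j, B ((Fin.snoc uu x₀ : Fin (k + 1) → V) i) ((Fin.snoc uu x₀ : Fin (k + 1) → V) j) = (0 : ℚ)) ∧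
      (∀ i j, B ((Fin.snoc uu x₀ : Fin (k + 1) → V) i) ((Fin.snoc ww y₁ : Fin (k + 1) → V) j) = if i = j then (1 : ℚ) else 0) ∧
      (∀ i j, B ((Fin.snoc ww y₁ : Fin (k + 1) → V) i) ((Fin.snoc ww y₁ : Fin (k + 1) → V) j) = (0 : ℚ)) := by
    intro k uu ww x₀ y₁ hU hUW hW hxy hxo hyo
    have hxu : ∀ i, B x₀ (uu i) = 0 := fun i => by rw [← hB.neg_eq, (hxo i).1, neg_zero]
    have hxw : ∀ i, B x₀ (ww i) = 0 := fun i => by rw [← hB.neg_eq, (hxo i).2, neg_zero]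
    have hyu : ∀ i, B y₁ (uu i) = 0 := fun i => by rw [← hB.neg_eq, (hyo i).1, neg_zero]
    have hyw : ∀ i, B y₁ (ww i) = 0 := fun i => by rw [← hB.neg_eq, (hyo i).2, neg_zero]
    refine ⟨fun i j => ?_, fun i j => ?_, fun i j => ?_⟩
    · refine Fin.lastCases ?_ (fun i => ?_) i <;> refine Fin.lastCases ?_ (fun j => ?_) j
      · simp only [Fin.snoc_last, hB.self_eq_zero]
      · simp only [Fin.snoc_last, Fin.snoc_castSucc, hxu]
      · simp only [Fin.snoc_last, Fin.snoc_castSucc, (hxo i).1]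
      · simp only [Fin.snoc_castSucc, hU]
    · refine Fin.lastCases ?_ (fun i => ?_) i <;> refine Fin.lastCases ?_ (fun j => ?_) j
      · simp only [Fin.snoc_last, hxy, if_true]
      · simp only [Fin.snoc_last, Fin.snoc_castSucc, hxw, (Fin.castSucc_lt_last j).ne', if_false]
      · simp only [Fin.snoc_last, Fin.snoc_castSucc, (hyo i).1, (Fin.castSucc_lt_last i).ne, if_false]
      · simp only [Fin.snoc_castSucc, hUW, Fin.castSucc_inj]
    · refine Fin.lastCases ?_ (fun i => ?_) i <;> refine Fin.lastCases ?_ (fun j => ?_) j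
      · simp only [Fin.snoc_last, hB.self_eq_zero]
      · simp only [Fin.snoc_last, Fin.snoc_castSucc, hyw]
      · simp only [Fin.snoc_last, Fin.snoc_castSucc, (hyo i).2]
      · simp only [Fin.snoc_castSucc, hW]
  intro n
  induction n with
  | zero =>
    intro k uu ww huu hww hU hUW hW hdim g hgC hfix
    by_cases hcase : ∃ m ∈ Submodule.span ℤ S, (∀ i, B (uu i) m = 0 ∧ B (ww i) m = 0) ∧
        ∃ y ∈ Submodule.span ℤ S, B m y ≠ 0
    · -- impossible: a symplectic family of `k + 1` pairs in dimension `≤ 2k`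
      exfalso
      obtain ⟨x₀, hx₀, y₁, hy₁, hxy, hxo, hyo⟩ := hnewpair k uu ww huu hww hU hUW hW hcase
      obtain ⟨hU', hUW', hW'⟩ := hext k uu ww x₀ y₁ hU hUW hW hxy hxo hyo
      have hWU' : ∀ i j, B ((Fin.snoc ww y₁ : Fin (k + 1) → V) i) ((Fin.snoc uu x₀ : Fin (k + 1) → V) j) = if i = j then (-1 : ℚ) else 0 :=
        fun i j => by
          rw [← hB.neg_eq, hUW']
          split_ifs with h1 h2 h2
          · rfl
          · exact absurd h1.symm h2
          · exact absurd h2.symm h1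
          · rw [neg_zero]
      have := localTubeSpan_symplecticFamily_card_le B ((Fin.snoc uu x₀ : Fin (k + 1) → V)) ((Fin.snoc ww y₁ : Fin (k + 1) → V)) hU' hW' hUW' hWU'
      omega
    · push Not at hcase
      have hone : g = 1 := localTubeSpan_theoremU_isotropicEnd B hB S hint hfg hsp uu ww huu hww hU hUW hW
        (fun m hm hmo y hy => hcase m hm hmo y hy) g hgC.2.2.2 hfix
      rw [hone]
      exact one_mem _
  | succ n ih =>
    intro k uu ww huu hww hU hUW hW hdim g hgC hfix
    by_cases hcase : ∃ m ∈ Submodule.span ℤ S, (∀ i, B (uu i) m = 0 ∧ B (ww i) m = 0) ∧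
        ∃ y ∈ Submodule.span ℤ S, B m y ≠ 0
    · obtain ⟨x₀, hx₀, y₁, hy₁, hxy, hxo, hyo⟩ := hnewpair k uu ww huu hww hU hUW hW hcase
      obtain ⟨h, hhG, hhC, hhF, hhx, hhy⟩ := localTubeSpan_theoremU_step B hB S hint hfg hsp G hsq uu ww
        hx₀ hy₁ hxy hxo hyo g hgC.1 hgC.2.1 hgC.2.2.1 hgC.2.2.2 hfix
      -- `g' := h⁻¹ g` fixes the extended family; induction hypothesis
      set g' : (V →ₗ[ℚ] V)ˣ := h⁻¹ * g with hg'def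
      have hg'C : C g' := hCmul _ _ (hCinv _ hhC) hgC
      have hg'fix : ∀ i, (g' : V →ₗ[ℚ] V) ((Fin.snoc uu x₀ : Fin (k + 1) → V) i) = (Fin.snoc uu x₀ : Fin (k + 1) → V) i ∧
          (g' : V →ₗ[ℚ] V) ((Fin.snoc ww y₁ : Fin (k + 1) → V) i) = (Fin.snoc ww y₁ : Fin (k + 1) → V) i := by
        intro i
        refine Fin.lastCases ?_ (fun i => ?_) i
        · simp only [Fin.snoc_last]
          exact ⟨hhx, hhy⟩
        · simp only [Fin.snoc_castSucc]
          constructor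
          · rw [hg'def, Units.val_mul, Module.End.mul_apply, (hfix i).1]
            conv_lhs => rw [← (hhF i).1]
            rw [localTubeSpan_units_inv_apply_apply]
          · rw [hg'def, Units.val_mul, Module.End.mul_apply, (hfix i).2]
            conv_lhs => rw [← (hhF i).2]
            rw [localTubeSpan_units_inv_apply_apply]
      obtain ⟨hU', hUW', hW'⟩ := hext k uu ww x₀ y₁ hU hUW hW hxy hxo hyo
      have huu' : ∀ i, (Fin.snoc uu x₀ : Fin (k + 1) → V) i ∈ Submodule.span ℤ S := fun i =>
        Fin.lastCases (by simp only [Fin.snoc_last]; exact hx₀) (fun i => by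
          simp only [Fin.snoc_castSucc]; exact huu i) i
      have hww' : ∀ i, (Fin.snoc ww y₁ : Fin (k + 1) → V) i ∈ Submodule.span ℤ S := fun i =>
        Fin.lastCases (by simp only [Fin.snoc_last]; exact hy₁) (fun i => by
          simp only [Fin.snoc_castSucc]; exact hww i) i
      have hmem : g' ∈ G := ih (k + 1) ((Fin.snoc uu x₀ : Fin (k + 1) → V)) ((Fin.snoc ww y₁ : Fin (k + 1) → V)) huu' hww' hU' hUW' hW'
        (by omega) g' hg'C hg'fix
      have : g = h * g' := by rw [hg'def, mul_inv_cancel_left]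
      rw [this]
      exact mul_mem hhG hmem
    · push Not at hcase
      have hone : g = 1 := localTubeSpan_theoremU_isotropicEnd B hB S hint hfg hsp uu ww huu hww hU hUW hW
        (fun m hm hmo y hy => hcase m hm hmo y hy) g hgC.2.2.2 hfix
      rw [hone]
      exact one_mem _


/-- **The conclusion of Janssen's Theorem 2.5 for every skew vanishing lattice unimodular modulo its
radical** (`UNI⋆(ℤΔ)`): every unit satisfying the four `Sp♯₂(ℤΔ)` conditions is monodromy — Theorem U with
`G = Γ_Δ` and the squares of Part A (`localTubeSpan_squares_all`).  No named fact.
[cite: Janssen1983, Thm. 2.5] -/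
theorem localTubeSpan_sp2_mem_of_uniStar [FiniteDimensional ℚ V] (B : LinearMap.BilinForm ℚ V)
    (hB : B.IsAlt) (Δ : Set V) (hΔ : IsSkewVanishingLattice B Δ)
    (huni : ∀ x ∈ Submodule.span ℤ Δ, (∃ y ∈ Submodule.span ℤ Δ, B x y ≠ 0) →
      ∃ x₀ ∈ Submodule.span ℤ Δ, ∃ c : ℤ, ∃ r ∈ Submodule.span ℤ Δ,
        (∀ y ∈ Submodule.span ℤ Δ, B r y = 0) ∧ x = (c : ℚ) • x₀ + r ∧
        ∃ y ∈ Submodule.span ℤ Δ, B x₀ y = 1)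
    (g : (V →ₗ[ℚ] V)ˣ)
    (h1 : ∀ x y : V, B ((g : V →ₗ[ℚ] V) x) ((g : V →ₗ[ℚ] V) y) = B x y)
    (h2 : ∀ x ∈ Submodule.span ℤ Δ, (g : V →ₗ[ℚ] V) x ∈ Submodule.span ℤ Δ)
    (h3 : ∀ x ∈ Submodule.span ℤ Δ, ((g⁻¹ : (V →ₗ[ℚ] V)ˣ) : V →ₗ[ℚ] V) x ∈ Submodule.span ℤ Δ)
    (h4 : ∀ l : V →ₗ[ℚ] ℚ, (∀ x ∈ Submodule.span ℤ Δ, ∃ z : ℤ, l x = z) →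
      ∃ v ∈ Submodule.span ℤ Δ, ∀ x ∈ Submodule.span ℤ Δ, l ((g : V →ₗ[ℚ] V) x - x) = 2 * B v x) :
    g ∈ transvectionGroup B Δ :=
  localTubeSpan_theoremU B hB Δ hΔ.integral hΔ.fg hΔ.span_eq_top huni (transvectionGroup B Δ)
    (fun _ ha => localTubeSpan_squares_all B hB Δ hΔ ha) g h1 h2 h3 h4

/-- **The conclusion of Janssen's Theorem 2.5 for every skew vanishing lattice whose lattice is unimodular
modulo its radical in the functional form**: if every `ℚ`-linear functional integral on `ℤΔ` and killing
the radical vectors of `ℤΔ` is `⟨v, ·⟩` on `ℤΔ` for some `v ∈ ℤΔ`, then every unit satisfying the four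
`Sp♯₂(ℤΔ)` conditions lies in `Γ_Δ` (`localTubeSpan_sp2_mem_of_uniStar` + `localTubeSpan_uniStar_of_unimodular`).
In particular Janssen's theorem holds unconditionally for UNIMODULAR skew vanishing lattices.  No named fact.
[cite: Janssen1983, Thm. 2.5] -/
theorem localTubeSpan_sp2_mem_of_unimodular [FiniteDimensional ℚ V] (B : LinearMap.BilinForm ℚ V)
    (hB : B.IsAlt) (Δ : Set V) (hΔ : IsSkewVanishingLattice B Δ)
    (hunimod : ∀ l : V →ₗ[ℚ] ℚ, (∀ a ∈ Submodule.span ℤ Δ, ∃ z : ℤ, l a = z) →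
      (∀ r ∈ Submodule.span ℤ Δ, (∀ y ∈ Submodule.span ℤ Δ, B r y = 0) → l r = 0) →
      ∃ v ∈ Submodule.span ℤ Δ, ∀ a ∈ Submodule.span ℤ Δ, l a = B v a)
    (g : (V →ₗ[ℚ] V)ˣ)
    (h1 : ∀ x y : V, B ((g : V →ₗ[ℚ] V) x) ((g : V →ₗ[ℚ] V) y) = B x y)
    (h2 : ∀ x ∈ Submodule.span ℤ Δ, (g : V →ₗ[ℚ] V) x ∈ Submodule.span ℤ Δ)
    (h3 : ∀ x ∈ Submodule.span ℤ Δ, ((g⁻¹ : (V →ₗ[ℚ] V)ˣ) : V →ₗ[ℚ] V) x ∈ Submodule.span ℤ Δ)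
    (h4 : ∀ l : V →ₗ[ℚ] ℚ, (∀ x ∈ Submodule.span ℤ Δ, ∃ z : ℤ, l x = z) →
      ∃ v ∈ Submodule.span ℤ Δ, ∀ x ∈ Submodule.span ℤ Δ, l ((g : V →ₗ[ℚ] V) x - x) = 2 * B v x) :
    g ∈ transvectionGroup B Δ :=
  localTubeSpan_sp2_mem_of_uniStar B hB Δ hΔ
    (fun _ hx hxnr => localTubeSpan_uniStar_of_unimodular B hB Δ hΔ.integral hunimod hx hxnr) g h1 h2 h3 h4

end Summit.HodgeConjecture.HodgeConjecture.Theorems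

end
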